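import Mathlib

/-!
NU4-SIZING §M′ sketch (idea-3 g15; custody; sizing / record only — NOT a proposal, NOT engine text,
NOT a re-deal request).  The «(CERT-JAC)» re-cut of the (S1) supplier of door ν4 and the
EQUIMULTIPLE strict-transform chart lemma (EQ3¹).  AI-written signatures, weaker than expert review;
nothing here is proved (every statement below is `sorry`); EL♮(3) is NOT proved.

Compared with `NU4_M_sketch.lean` (g14, 4be55af70be20011):
* `exists_equimultiple_lift_of_jac` replaces the pair (hord, hcert) of `exists_equinodal_lift` by the
  single hypothesis `hjac : (jacBlock ḡ n̄ m).det ≠ 0` — the explicit 3δ × 3δ Jacobi block of the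
  marked-double-point relation family at the special point, for a NAMED pivot choice `m` (one degree-`e`
  exponent vector per marked point).  The supplier's proof route loses (m2) and (m5) of NU4-SIZING §0:
  the special point of `A = O[σ, t] ⧸ (v, t·Δ − 1)` is `(c̄, n̄, Δ̄⁻¹)` directly; (m1), (m3) (`jacobian = Δ²`
  via `Algebra.PreSubmersivePresentation.jacobiMatrix_naive` + `Matrix.det_fromBlocks_zero₂₁`) and (m4)
  (`Algebra.FormallySmooth.exists_mkₐ_comp_eq_of_isAdicComplete`) are unchanged.  No Hessian in the
  conclusion: EQ3¹ below needs only `g_O ∈ 𝔪_𝓃²`, which IS the conclusion `g(n) = ∇g(n) = 0`.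
* `jac_of_ord_of_certDet` = (m2) demoted to a CUSTOMER-side lemma: (ordinary ∧ invertible δ × δ
  evaluation minor) ⇒ hjac.  Off the critical path of the L.
* `strictTransform_equimultiple_chart` + `isUnit_eval_pderiv_of_residue_ne_zero` = EQ3¹: for
  `G ∈ (u, v)^m ⊂ O[u, v]` the chart strict transform `G′` (`G(v u′, v) = v^m G′`) reduces mod `𝔪_O` to the
  chart strict transform of `Ḡ`; hence `V(G′) → Spec O` is smooth at every point of `v = 0` where the
  reduced strict transform has a non-vanishing partial (downstairs: «Z̃ regular over the marked point»).
  Serves nodes AND cusps AND ordinary m-fold points uniformly (depth-1 equimultiplicity).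
-/

open MvPolynomial IsLocalRing

namespace NU4JacSketch

/-- the three relation operators of a marked double point in the chart `x₂ = 1`:
`D 0 = id` (value), `D 1 = ∂/∂x₀`, `D 2 = ∂/∂x₁`. -/
noncomputable def opD {R : Type*} [CommRing R] (a : Fin 3) (p : MvPolynomial (Fin 3) R) :
    MvPolynomial (Fin 3) R :=
  if a = 0 then p else if a = 1 then pderiv 0 p else pderiv 1 p

/-- **The explicit Jacobi block at the special point** (rows = relations `(i, a)`: `D a ḡ` vanishes at
node `i`; columns = pivot variables `(i′, b)`: `b = 0, 1` the two chart coordinates of node `i′`,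
`b = 2` the coefficient of the pivot monomial `x^(m i′)`).  Entry = ∂(relation)/∂(pivot variable)
evaluated at `(c̄, n̄)`: moving node `i′` differentiates `D a ḡ` once more (only if `i = i′`); moving the
coefficient of `x^(m i′)` replaces `ḡ` by that monomial. -/
noncomputable def jacBlock {k : Type*} [CommRing k] {δ : ℕ} (g : MvPolynomial (Fin 3) k)
    (n : Fin δ → Fin 3 → k) (m : Fin δ → (Fin 3 →₀ ℕ)) :
    Matrix (Fin δ × Fin 3) (Fin δ × Fin 3) k :=
  Matrix.of fun r c =>
    if c.2 = 2 then eval (n r.1) (opD r.2 (monomial (m c.1) (1 : k)))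
    else if r.1 = c.1 then eval (n r.1) (opD r.2 (pderiv c.2 g)) else 0

/-- affine Hessian discriminant `H₀₀ H₁₁ − H₀₁²` in the chart `x₂ = 1` (as in the g14 sketch). -/
noncomputable def hessDisc {R : Type*} [CommRing R] (g : MvPolynomial (Fin 3) R) (v : Fin 3 → R) : R :=
  eval v (pderiv 0 (pderiv 0 g)) * eval v (pderiv 1 (pderiv 1 g)) - eval v (pderiv 0 (pderiv 1 g)) ^ 2

/-- **Equimultiple (double-point) Hensel lift from the Jacobian certificate (sketch signature).**
A degree-`e` ternary form `ḡ` over the residue field of a complete local ring `O` with `δ` marked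
double points in the chart `x₂ = 1` (NOT assumed ordinary) and a pivot choice `m` with invertible Jacobi
block lifts to a degree-`e` form over `O` with `O`-valued marked vectors at which the lift and its
partials vanish (i.e. `g ∈ 𝔪_𝓃ᵢ²` for every `i`). -/
theorem exists_equimultiple_lift_of_jac
    (O : Type) [CommRing O] [IsLocalRing O] [IsAdicComplete (maximalIdeal O) O]
    (e δ : ℕ)
    (gbar : MvPolynomial (Fin 3) (ResidueField O)) (hgbar : gbar.IsHomogeneous e)
    (nbar : Fin δ → Fin 3 → ResidueField O) (hchart : ∀ i, nbar i 2 = 1)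
    (hnode : ∀ i, eval (nbar i) gbar = 0 ∧ ∀ j, eval (nbar i) (pderiv j gbar) = 0)
    (m : Fin δ → (Fin 3 →₀ ℕ)) (hm : ∀ i, (m i).degree = e)
    (hjac : (jacBlock gbar nbar m).det ≠ 0) :
    ∃ (g : MvPolynomial (Fin 3) O) (n : Fin δ → Fin 3 → O),
      g.IsHomogeneous e ∧ MvPolynomial.map (residue O) g = gbar ∧
      (∀ i j, residue O (n i j) = nbar i j) ∧ (∀ i, n i 2 = 1) ∧
      (∀ i, eval (n i) g = 0 ∧ ∀ j, eval (n i) (pderiv j g) = 0) := by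
  sorry

/-- **(m2) as a customer-side lemma**: ordinary marked nodes + an invertible δ × δ evaluation minor of the
pivot monomials ⇒ the Jacobi block is invertible (block-triangular at the special point because
`∇ḡ(n̄ᵢ) = 0`: `det = ± ∏ᵢ hessDisc ḡ n̄ᵢ · det (evaluation minor)`). -/
theorem jac_of_ord_of_certDet {k : Type} [Field k] {e δ : ℕ} (gbar : MvPolynomial (Fin 3) k)
    (nbar : Fin δ → Fin 3 → k) (hchart : ∀ i, nbar i 2 = 1)
    (hnode : ∀ i, eval (nbar i) gbar = 0 ∧ ∀ j, eval (nbar i) (pderiv j gbar) = 0)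
    (m : Fin δ → (Fin 3 →₀ ℕ)) (hm : ∀ i, (m i).degree = e)
    (hord : ∀ i, hessDisc gbar (nbar i) ≠ 0)
    (hdet : (Matrix.of fun i j => eval (nbar i) (monomial (m j) (1 : k))).det ≠ 0) :
    (jacBlock gbar nbar m).det ≠ 0 := by
  sorry

/-- **EQ3¹, equimultiple strict-transform chart lemma (sketch signature).**  For `G ∈ (u, v)^m ⊂ O[u, v]`
(`u = X 0`, `v = X 1`; the section translated to the origin) the blow-up chart `u = v·u′` admits the exact
division `G(v u′, v) = v^m · G′`, and `G′` reduces modulo `𝔪_O` to the polynomial obtained from `Ḡ` by the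
same recipe (uniqueness of exact division by `v^m` over the residue FIELD). -/
theorem strictTransform_equimultiple_chart (O : Type) [CommRing O] [IsLocalRing O]
    (m : ℕ) (G : MvPolynomial (Fin 2) O)
    (hG : G ∈ (Ideal.span {(X 0 : MvPolynomial (Fin 2) O), X 1}) ^ m) :
    ∃ G' : MvPolynomial (Fin 2) O,
      aeval (fun i : Fin 2 => if i = 0 then X 0 * X 1 else (X 1 : MvPolynomial (Fin 2) O)) G
        = X 1 ^ m * G' ∧
      ∀ Gbar' : MvPolynomial (Fin 2) (ResidueField O),
        aeval (fun i : Fin 2 => if i = 0 then X 0 * X 1 else (X 1 : MvPolynomial (Fin 2) (ResidueField O)))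
            (MvPolynomial.map (residue O) G) = X 1 ^ m * Gbar' →
        MvPolynomial.map (residue O) G' = Gbar' := by
  sorry

/-- **EQ3¹, smoothness read-off**: a partial derivative of `G′` whose reduction does not vanish at a
residue point `q̄` is a UNIT of `O` at any lift `q` of `q̄` — the Jacobian criterion then makes
`Spec O[u′, v]/(G′) → Spec O` smooth of relative dimension one at that point.  (Downstairs input:
«the reduced strict transform Z̃ is regular at its points over the marked point».) -/
theorem isUnit_eval_pderiv_of_residue_ne_zero (O : Type) [CommRing O] [IsLocalRing O]
    (G' : MvPolynomial (Fin 2) O) (q : Fin 2 → O) (i : Fin 2)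
    (h : eval (fun j => residue O (q j)) (pderiv i (MvPolynomial.map (residue O) G')) ≠ 0) :
    IsUnit (eval q (pderiv i G')) := by
  sorry

end NU4JacSketch
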